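import Literature.RingTheory.Elimination.PerturbedCharpoly
import HarnessLib

/-!
# Degrees in the base variables for the perturbed characteristic polynomial

Topic: `Literature/RingTheory/Elimination`; sequel of `PerturbedCharpoly.lean`. When the square
system `F_1, …, F_n ∈ B[X_1, …, X_n]` has coefficients in a polynomial ring `B = R₀[τ]` (parameters,
indeterminate combination coefficients, the coefficients of a generic linear form …), the leading
`s`-form `Q_u = sLead (pertCharpoly D F u k) ∈ B[T]` of Canny's generalised characteristic polynomial
(J. Symbolic Comput. 9 (1990), §3: the GCP is a determinant of size `Dⁿ` whose entries are
polynomials in the input coefficients) has `τ`-degrees controlled linearly in the number `k` of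
rewriting passes: if every coefficient of every `F_i` has `τ`-degree `≤ δ` and every coefficient of
`u` has `τ`-degree `≤ δᵤ`, then

* `totalDegree_coeff_sLead_pertCharpoly_le` — **every coefficient of `Q_u` has `τ`-degree
  `≤ Dⁿ · (δᵤ + k δ)`**.

The proof is the degree analogue of the weight bookkeeping of
`Literature/Computability/AlgebraicComplexity/BurgisserPerturbedCharpolyHeight.lean`: one
rewriting pass raises the `τ`-degree of the `B[s]`-coefficients by at most `δ` (`cdegM_reduceStep_le`),
and the Leibniz expansion of `det (T - M)` adds up the column bounds (`cdegP_charpoly_le`).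

* `cdeg`, `cdegM`, `cdegP` — the maximal `τ`-degree of the `R₀[τ]`-coefficients of an element of
  `B[s]`, of `B[s][X_1, …, X_n]`, of `B[s][T]`, with their (max, +) calculus.

## References

* J. Canny, *Generalised characteristic polynomials*, J. Symbolic Comput. 9 (1990) 241–250, §3.
  [Canny1990GCP]
* P. Bürgisser, *Cook's versus Valiant's hypothesis*, TCS 235 (2000), Thm. 4.5 (degree
  `d^{O(n)}`). [Burgisser2000TCS]
-/

noncomputable section

namespace Literature.RingTheory.Elimination

open MvPolynomial

variable {R₀ : Type*} [CommRing R₀] {τ : Type*}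

/-! ### `τ`-degree of the coefficients of an element of `B[s]`, `B = R₀[τ]` -/

section CDeg

/-- `cdeg a`: the largest total `τ`-degree of an `s`-coefficient of `a ∈ R₀[τ][s]`. [folklore] -/
private def cdeg (a : Polynomial (MvPolynomial τ R₀)) : ℕ := a.support.sup fun j => (a.coeff j).totalDegree

/-- Every coefficient is bounded by `cdeg`. [folklore] -/
private theorem totalDegree_coeff_le_cdeg (a : Polynomial (MvPolynomial τ R₀)) (j : ℕ) :
    (a.coeff j).totalDegree ≤ cdeg a := by
  by_cases hj : j ∈ a.support
  · exact Finset.le_sup (f := fun j => (a.coeff j).totalDegree) hj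
  · rw [Polynomial.notMem_support_iff.1 hj, totalDegree_zero]; exact Nat.zero_le _

/-- `cdeg a ≤ N` iff every coefficient has degree `≤ N`. [folklore] -/
private theorem cdeg_le_iff {a : Polynomial (MvPolynomial τ R₀)} {N : ℕ} :
    cdeg a ≤ N ↔ ∀ j, (a.coeff j).totalDegree ≤ N :=
  ⟨fun h j => (totalDegree_coeff_le_cdeg a j).trans h, fun h => Finset.sup_le fun j _ => h j⟩

/-- `cdeg 0 = 0`. [folklore] -/
@[simp] private theorem cdeg_zero : cdeg (0 : Polynomial (MvPolynomial τ R₀)) = 0 := by simp [cdeg]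

/-- `cdeg (C b) ≤ deg b`. [folklore] -/
private theorem cdeg_C_le (b : MvPolynomial τ R₀) : cdeg (Polynomial.C b) ≤ b.totalDegree := by
  rw [cdeg_le_iff]; intro j
  rw [Polynomial.coeff_C]; split_ifs
  · exact le_rfl
  · rw [totalDegree_zero]; exact Nat.zero_le _

/-- `cdeg s = 0`. [folklore] -/
private theorem cdeg_X : cdeg (Polynomial.X : Polynomial (MvPolynomial τ R₀)) = 0 := by
  apply Nat.eq_zero_of_le_zero
  rw [cdeg_le_iff]; intro j
  rw [Polynomial.coeff_X]; split_ifs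
  · rw [totalDegree_one]
  · rw [totalDegree_zero]

/-- Subadditivity (as a maximum). [folklore] -/
private theorem cdeg_add_le {a b : Polynomial (MvPolynomial τ R₀)} {N : ℕ} (ha : cdeg a ≤ N) (hb : cdeg b ≤ N) :
    cdeg (a + b) ≤ N := by
  rw [cdeg_le_iff] at ha hb ⊢
  intro j
  rw [Polynomial.coeff_add]
  exact (totalDegree_add _ _).trans (max_le (ha j) (hb j))

/-- `cdeg (-a) = cdeg a`. [folklore] -/
@[simp] private theorem cdeg_neg (a : Polynomial (MvPolynomial τ R₀)) : cdeg (-a) = cdeg a := by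
  simp [cdeg, Polynomial.support_neg]

/-- Differences. [folklore] -/
private theorem cdeg_sub_le {a b : Polynomial (MvPolynomial τ R₀)} {N : ℕ} (ha : cdeg a ≤ N) (hb : cdeg b ≤ N) :
    cdeg (a - b) ≤ N := by
  rw [cdeg_le_iff] at ha hb ⊢
  intro j
  rw [Polynomial.coeff_sub]
  exact (totalDegree_sub _ _).trans (max_le (ha j) (hb j))

/-- Integer multiples do not raise degrees. [folklore] -/
private theorem cdeg_zsmul_le (z : ℤ) (a : Polynomial (MvPolynomial τ R₀)) : cdeg (z • a) ≤ cdeg a := by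
  rw [cdeg_le_iff]; intro j
  rw [Polynomial.coeff_smul]
  exact (Finset.sup_mono MvPolynomial.support_smul).trans (totalDegree_coeff_le_cdeg a j)

/-- Sums. [folklore] -/
private theorem cdeg_sum_le {ι : Type*} (s : Finset ι) (f : ι → Polynomial (MvPolynomial τ R₀)) {N : ℕ}
    (h : ∀ i ∈ s, cdeg (f i) ≤ N) : cdeg (∑ i ∈ s, f i) ≤ N := by
  classical
  induction s using Finset.cons_induction with
  | empty => simp
  | cons a s ha ih =>
    rw [Finset.sum_cons]
    exact cdeg_add_le (h a (Finset.mem_cons_self a s)) (ih fun i hi => h i (Finset.mem_cons_of_mem hi))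

/-- Submultiplicativity (degrees add). [folklore] -/
private theorem cdeg_mul_le (a b : Polynomial (MvPolynomial τ R₀)) : cdeg (a * b) ≤ cdeg a + cdeg b := by
  classical
  rw [cdeg_le_iff]; intro j
  rw [Polynomial.coeff_mul]
  refine (totalDegree_finsetSum _ _).trans (Finset.sup_le fun p _ => ?_)
  exact (totalDegree_mul _ _).trans
    (Nat.add_le_add (totalDegree_coeff_le_cdeg a _) (totalDegree_coeff_le_cdeg b _))

/-- Products. [folklore] -/
private theorem cdeg_prod_le {ι : Type*} (s : Finset ι) (f : ι → Polynomial (MvPolynomial τ R₀)) :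
    cdeg (∏ i ∈ s, f i) ≤ ∑ i ∈ s, cdeg (f i) := by
  classical
  induction s using Finset.cons_induction with
  | empty => rw [Finset.prod_empty, Finset.sum_empty, ← Polynomial.C_1]
             exact (cdeg_C_le _).trans (by rw [totalDegree_one])
  | cons a s ha ih =>
    rw [Finset.prod_cons, Finset.sum_cons]
    exact (cdeg_mul_le _ _).trans (Nat.add_le_add_left ih _)


end CDeg

/-! ### `τ`-degree of the coefficients of an element of `B[s][X_1, …, X_n]` -/

section CDegM

variable {σ : Type*}

/-- `cdegM q`: the largest `cdeg` of an `X`-coefficient of `q ∈ R₀[τ][s][X_σ]`. [folklore] -/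
private def cdegM (q : MvPolynomial σ (Polynomial (MvPolynomial τ R₀))) : ℕ := q.support.sup fun β => cdeg (q.coeff β)

/-- Every coefficient is bounded by `cdegM`. [folklore] -/
private theorem cdeg_coeff_le_cdegM (q : MvPolynomial σ (Polynomial (MvPolynomial τ R₀))) (β : σ →₀ ℕ) :
    cdeg (q.coeff β) ≤ cdegM q := by
  classical
  by_cases hβ : β ∈ q.support
  · exact Finset.le_sup (f := fun β => cdeg (q.coeff β)) hβ
  · rw [notMem_support_iff.1 hβ, cdeg_zero]; exact Nat.zero_le _

/-- `cdegM q ≤ N` iff every coefficient has `cdeg ≤ N`. [folklore] -/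
private theorem cdegM_le_iff {q : MvPolynomial σ (Polynomial (MvPolynomial τ R₀))} {N : ℕ} :
    cdegM q ≤ N ↔ ∀ β, cdeg (q.coeff β) ≤ N :=
  ⟨fun h β => (cdeg_coeff_le_cdegM q β).trans h, fun h => Finset.sup_le fun β _ => h β⟩

/-- Monomials. [folklore] -/
private theorem cdegM_monomial_le (β : σ →₀ ℕ) (a : Polynomial (MvPolynomial τ R₀)) :
    cdegM (monomial β a) ≤ cdeg a := by
  classical
  rw [cdegM_le_iff]; intro γ
  rw [coeff_monomial]; split_ifs
  · exact le_rfl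
  · rw [cdeg_zero]; exact Nat.zero_le _

/-- Sums. [folklore] -/
private theorem cdegM_add_le {p q : MvPolynomial σ (Polynomial (MvPolynomial τ R₀))} {N : ℕ}
    (hp : cdegM p ≤ N) (hq : cdegM q ≤ N) : cdegM (p + q) ≤ N := by
  rw [cdegM_le_iff] at hp hq ⊢
  intro β; rw [coeff_add]; exact cdeg_add_le (hp β) (hq β)

/-- Finite sums. [folklore] -/
private theorem cdegM_sum_le {ι : Type*} (s : Finset ι) (f : ι → MvPolynomial σ (Polynomial (MvPolynomial τ R₀)))
    {N : ℕ} (h : ∀ i ∈ s, cdegM (f i) ≤ N) : cdegM (∑ i ∈ s, f i) ≤ N := by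
  classical
  induction s using Finset.cons_induction with
  | empty => simp [cdegM]
  | cons a s ha ih =>
    rw [Finset.sum_cons]
    exact cdegM_add_le (h a (Finset.mem_cons_self a s)) (ih fun i hi => h i (Finset.mem_cons_of_mem hi))

/-- `monomial β a * q`: degrees add. [folklore] -/
private theorem cdegM_monomial_mul_le (β : σ →₀ ℕ) (a : Polynomial (MvPolynomial τ R₀))
    (q : MvPolynomial σ (Polynomial (MvPolynomial τ R₀))) :
    cdegM (monomial β a * q) ≤ cdeg a + cdegM q := by
  classical
  have hq : monomial β a * q = ∑ γ ∈ q.support, monomial (β + γ) (a * coeff γ q) := by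
    conv_lhs => rw [← support_sum_monomial_coeff q, Finset.mul_sum]
    refine Finset.sum_congr rfl fun γ _ => ?_
    rw [monomial_mul]
  rw [hq]
  refine cdegM_sum_le _ _ fun γ _ => (cdegM_monomial_le _ _).trans ?_
  exact (cdeg_mul_le _ _).trans (Nat.add_le_add_left (cdeg_coeff_le_cdegM q γ) _)

/-- `C a * q`: degrees add. [folklore] -/
private theorem cdegM_C_mul_le (a : Polynomial (MvPolynomial τ R₀)) (q : MvPolynomial σ (Polynomial (MvPolynomial τ R₀))) :
    cdegM (C a * q) ≤ cdeg a + cdegM q := by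
  rw [← monomial_zero']; exact cdegM_monomial_mul_le _ _ _

/-- `cdegM (map C p)`: the `τ`-degrees of the coefficients of `p ∈ R₀[τ][X_σ]`. [folklore] -/
private theorem cdegM_map_C_le (p : MvPolynomial σ (MvPolynomial τ R₀)) {N : ℕ}
    (h : ∀ β, (p.coeff β).totalDegree ≤ N) : cdegM (map Polynomial.C p) ≤ N := by
  rw [cdegM_le_iff]; intro β
  rw [coeff_map]
  exact (cdeg_C_le _).trans (h β)

end CDegM

/-! ### Degree growth under rewriting -/

section Rewriting

variable {n D : ℕ}

/-- The perturbed tails have the `τ`-degrees of the coefficients of `F_i`. [folklore] -/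
private theorem cdegM_pertTail_le (F : Fin n → MvPolynomial (Fin n) (MvPolynomial τ R₀)) {δ : ℕ}
    (hF : ∀ i β, ((F i).coeff β).totalDegree ≤ δ) (i : Fin n) : cdegM (pertTail F i) ≤ δ := by
  classical
  unfold pertTail
  rw [cdegM_le_iff]; intro β
  rw [coeff_neg, cdeg_neg, C_mul', coeff_smul, coeff_map, smul_eq_mul]
  refine (cdeg_mul_le _ _).trans ?_
  rw [cdeg_X, zero_add]
  exact (cdeg_C_le _).trans (hF i β)

/-- One rewriting pass raises `cdegM` by at most `max_i cdegM T_i`. [folklore] -/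
private theorem cdegM_reduceStep_le (T : Fin n → MvPolynomial (Fin n) (Polynomial (MvPolynomial τ R₀))) {δ : ℕ}
    (hT : ∀ i, cdegM (T i) ≤ δ) (p : MvPolynomial (Fin n) (Polynomial (MvPolynomial τ R₀))) :
    cdegM (reduceStep D T p) ≤ cdegM p + δ := by
  classical
  unfold reduceStep
  refine cdegM_sum_le _ _ fun α _ => ?_
  unfold rewriteExp
  split_ifs with h
  · rw [← mul_assoc, C_mul_monomial, mul_one]
    refine (cdegM_monomial_mul_le _ _ _).trans ?_
    exact Nat.add_le_add (cdeg_coeff_le_cdegM p α) (hT _)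
  · rw [C_mul_monomial, mul_one]
    exact (cdegM_monomial_le _ _).trans ((cdeg_coeff_le_cdegM p α).trans (Nat.le_add_right _ _))

/-- `k` passes raise `cdegM` by at most `k δ`. [folklore] -/
private theorem cdegM_iterate_reduceStep_le (T : Fin n → MvPolynomial (Fin n) (Polynomial (MvPolynomial τ R₀)))
    {δ : ℕ} (hT : ∀ i, cdegM (T i) ≤ δ) (k : ℕ) (p : MvPolynomial (Fin n) (Polynomial (MvPolynomial τ R₀))) :
    cdegM ((reduceStep D T)^[k] p) ≤ cdegM p + k * δ := by
  induction k generalizing p with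
  | zero => simp
  | succ k ih =>
    rw [Function.iterate_succ_apply']
    refine (cdegM_reduceStep_le T hT _).trans ?_
    calc cdegM ((reduceStep D T)^[k] p) + δ ≤ cdegM p + k * δ + δ := Nat.add_le_add_right (ih p) _
      _ = cdegM p + (k + 1) * δ := by ring

/-- **Entries of the perturbed rewriting matrix** have `cdeg ≤ δᵤ + k δ`. [folklore] -/
private theorem cdeg_pertMatrix_le (F : Fin n → MvPolynomial (Fin n) (MvPolynomial τ R₀)) {δ δu : ℕ}
    (hF : ∀ i β, ((F i).coeff β).totalDegree ≤ δ) (u : MvPolynomial (Fin n) (MvPolynomial τ R₀))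
    (hu : ∀ β, (u.coeff β).totalDegree ≤ δu) (k : ℕ) (b' b : Fin n → Fin D) :
    cdeg (pertMatrix D F u k b' b) ≤ δu + k * δ := by
  classical
  unfold pertMatrix
  rw [rewriteMatrix_apply]
  refine (cdeg_coeff_le_cdegM _ _).trans ?_
  refine (cdegM_iterate_reduceStep_le (pertTail F) (cdegM_pertTail_le F hF) k _).trans ?_
  refine Nat.add_le_add_right ?_ _
  rw [mul_comm]
  refine (cdegM_monomial_mul_le _ _ _).trans ?_
  rw [← Polynomial.C_1]
  refine (Nat.add_le_add (cdeg_C_le _) (cdegM_map_C_le u hu)).trans ?_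
  rw [totalDegree_one, zero_add]

end Rewriting

/-! ### `τ`-degree on `B[s][T]` and the characteristic polynomial -/

section CDegP

/-- `cdegP P`: the largest `cdeg` of a `T`-coefficient of `P ∈ R₀[τ][s][T]`. [folklore] -/
private def cdegP (P : Polynomial (Polynomial (MvPolynomial τ R₀))) : ℕ := P.support.sup fun k => cdeg (P.coeff k)

/-- Every coefficient is bounded by `cdegP`. [folklore] -/
private theorem cdeg_coeff_le_cdegP (P : Polynomial (Polynomial (MvPolynomial τ R₀))) (k : ℕ) :
    cdeg (P.coeff k) ≤ cdegP P := by
  by_cases hk : k ∈ P.support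
  · exact Finset.le_sup (f := fun k => cdeg (P.coeff k)) hk
  · rw [Polynomial.notMem_support_iff.1 hk, cdeg_zero]; exact Nat.zero_le _

/-- `cdegP P ≤ N` iff every coefficient has `cdeg ≤ N`. [folklore] -/
private theorem cdegP_le_iff {P : Polynomial (Polynomial (MvPolynomial τ R₀))} {N : ℕ} :
    cdegP P ≤ N ↔ ∀ k, cdeg (P.coeff k) ≤ N :=
  ⟨fun h k => (cdeg_coeff_le_cdegP P k).trans h, fun h => Finset.sup_le fun k _ => h k⟩

/-- `cdegP (C a) ≤ cdeg a`. [folklore] -/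
private theorem cdegP_C_le (a : Polynomial (MvPolynomial τ R₀)) : cdegP (Polynomial.C a) ≤ cdeg a := by
  rw [cdegP_le_iff]; intro k
  rw [Polynomial.coeff_C]; split_ifs
  · exact le_rfl
  · rw [cdeg_zero]; exact Nat.zero_le _

/-- `cdegP T = 0`. [folklore] -/
private theorem cdegP_X : cdegP (Polynomial.X : Polynomial (Polynomial (MvPolynomial τ R₀))) = 0 := by
  apply Nat.eq_zero_of_le_zero
  rw [cdegP_le_iff]; intro k
  rw [Polynomial.coeff_X]; split_ifs
  · rw [← Polynomial.C_1]; exact (cdeg_C_le _).trans (by rw [totalDegree_one])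
  · rw [cdeg_zero]

/-- Sums. [folklore] -/
private theorem cdegP_add_le {P Q : Polynomial (Polynomial (MvPolynomial τ R₀))} {N : ℕ} (hP : cdegP P ≤ N)
    (hQ : cdegP Q ≤ N) : cdegP (P + Q) ≤ N := by
  rw [cdegP_le_iff] at hP hQ ⊢
  intro k; rw [Polynomial.coeff_add]; exact cdeg_add_le (hP k) (hQ k)

/-- `cdegP (-P) = cdegP P`. [folklore] -/
@[simp] private theorem cdegP_neg (P : Polynomial (Polynomial (MvPolynomial τ R₀))) : cdegP (-P) = cdegP P := by
  simp [cdegP, Polynomial.support_neg]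

/-- Differences. [folklore] -/
private theorem cdegP_sub_le {P Q : Polynomial (Polynomial (MvPolynomial τ R₀))} {N : ℕ} (hP : cdegP P ≤ N)
    (hQ : cdegP Q ≤ N) : cdegP (P - Q) ≤ N := by
  rw [cdegP_le_iff] at hP hQ ⊢
  intro k; rw [Polynomial.coeff_sub]; exact cdeg_sub_le (hP k) (hQ k)

/-- Finite sums. [folklore] -/
private theorem cdegP_sum_le {ι : Type*} (s : Finset ι) (f : ι → Polynomial (Polynomial (MvPolynomial τ R₀)))
    {N : ℕ} (h : ∀ i ∈ s, cdegP (f i) ≤ N) : cdegP (∑ i ∈ s, f i) ≤ N := by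
  classical
  induction s using Finset.cons_induction with
  | empty => simp [cdegP]
  | cons a s ha ih =>
    rw [Finset.sum_cons]
    exact cdegP_add_le (h a (Finset.mem_cons_self a s)) (ih fun i hi => h i (Finset.mem_cons_of_mem hi))

/-- Submultiplicativity (degrees add). [folklore] -/
private theorem cdegP_mul_le (P Q : Polynomial (Polynomial (MvPolynomial τ R₀))) :
    cdegP (P * Q) ≤ cdegP P + cdegP Q := by
  classical
  rw [cdegP_le_iff]; intro k
  rw [Polynomial.coeff_mul]
  refine cdeg_sum_le _ _ fun p _ => ?_
  exact (cdeg_mul_le _ _).trans (Nat.add_le_add (cdeg_coeff_le_cdegP P _) (cdeg_coeff_le_cdegP Q _))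

/-- Products. [folklore] -/
private theorem cdegP_prod_le {ι : Type*} (s : Finset ι) (f : ι → Polynomial (Polynomial (MvPolynomial τ R₀)))
    {N : ι → ℕ} (h : ∀ i ∈ s, cdegP (f i) ≤ N i) : cdegP (∏ i ∈ s, f i) ≤ ∑ i ∈ s, N i := by
  classical
  induction s using Finset.cons_induction with
  | empty => rw [Finset.prod_empty, Finset.sum_empty, ← Polynomial.C_1, ← Polynomial.C_1]
             exact (cdegP_C_le _).trans ((cdeg_C_le _).trans (by rw [totalDegree_one]))
  | cons a s ha ih =>
    rw [Finset.prod_cons, Finset.sum_cons]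
    exact (cdegP_mul_le _ _).trans (Nat.add_le_add (h a (Finset.mem_cons_self a s))
      (ih fun i hi => h i (Finset.mem_cons_of_mem hi)))

/-- Integer multiples (in particular signs) do not raise degrees. [folklore] -/
private theorem cdegP_zsmul_le (z : ℤ) (P : Polynomial (Polynomial (MvPolynomial τ R₀))) :
    cdegP (z • P) ≤ cdegP P := by
  rw [cdegP_le_iff]; intro k
  rw [Polynomial.coeff_smul]
  exact (cdeg_zsmul_le z _).trans (cdeg_coeff_le_cdegP P k)

/-- **Degrees of a characteristic polynomial**: if every entry of `M` has `cdeg ≤ E` then every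
coefficient of `charpoly M` has `cdeg ≤ |ι| · E` (Leibniz expansion). [folklore] -/
private theorem cdegP_charpoly_le {ι : Type*} [Fintype ι] [DecidableEq ι]
    (M : Matrix ι ι (Polynomial (MvPolynomial τ R₀))) {E : ℕ} (hM : ∀ i j, cdeg (M i j) ≤ E) :
    cdegP M.charpoly ≤ Fintype.card ι * E := by
  classical
  rw [Matrix.charpoly, Matrix.det_apply]
  refine cdegP_sum_le _ _ fun σ _ => ?_
  rw [Units.smul_def]
  refine (cdegP_zsmul_le _ _).trans ?_
  have hentry : ∀ j i, cdegP (M.charmatrix j i) ≤ E := by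
    intro j i
    rw [Matrix.charmatrix_apply, Matrix.diagonal_apply]
    split_ifs with h
    · exact cdegP_sub_le (by rw [cdegP_X]; exact Nat.zero_le _) ((cdegP_C_le _).trans (hM j i))
    · rw [zero_sub, cdegP_neg]; exact (cdegP_C_le _).trans (hM j i)
  refine (cdegP_prod_le _ _ (N := fun _ => E) fun i _ => hentry _ _).trans ?_
  rw [Finset.sum_const, Finset.card_univ, smul_eq_mul]

/-- The coefficients of the leading `s`-form are coefficients of coefficients of `P`:
their `τ`-degrees are `≤ cdegP P`. [folklore] -/
private theorem totalDegree_coeff_sLead_le (P : Polynomial (Polynomial (MvPolynomial τ R₀))) (k : ℕ) :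
    ((sLead P).coeff k).totalDegree ≤ cdegP P := by
  rw [coeff_sLead]
  exact (totalDegree_coeff_le_cdeg _ _).trans (cdeg_coeff_le_cdegP P k)

end CDegP

/-! ### The degree bound -/

section Main

variable {n D : ℕ}

/-- **`τ`-degrees of the leading `s`-form of the perturbed characteristic polynomial.** For a
square system `F_1, …, F_n ∈ R₀[τ][X_1, …, X_n]` whose coefficients have `τ`-degree `≤ δ`, a
polynomial `u` whose coefficients have `τ`-degree `≤ δᵤ`, and `k` rewriting passes, every
coefficient of `Q_u = sLead (pertCharpoly D F u k)` has `τ`-degree `≤ Dⁿ · (δᵤ + k δ)` (Canny's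
GCP is a `Dⁿ × Dⁿ` determinant with entries of degree `≤ δᵤ + k δ` in the input coefficients).
[cite: Canny1990GCP, §3] -/
theorem totalDegree_coeff_sLead_pertCharpoly_le (F : Fin n → MvPolynomial (Fin n) (MvPolynomial τ R₀))
    {δ δu : ℕ} (hF : ∀ i β, ((F i).coeff β).totalDegree ≤ δ) (u : MvPolynomial (Fin n) (MvPolynomial τ R₀))
    (hu : ∀ β, (u.coeff β).totalDegree ≤ δu) (k j : ℕ) :
    ((sLead (pertCharpoly D F u k)).coeff j).totalDegree ≤ D ^ n * (δu + k * δ) := by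
  classical
  refine (totalDegree_coeff_sLead_le _ _).trans ?_
  unfold pertCharpoly
  refine (cdegP_charpoly_le _ fun b' b => cdeg_pertMatrix_le F hF u hu k b' b).trans ?_
  rw [Fintype.card_fun, Fintype.card_fin, Fintype.card_fin]

end Main

end Literature.RingTheory.Elimination

end
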